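import Summits.ValiantsHypothesis.ValiantsHypothesis.Theorems.VPBoundarySquareNbGRHSlot
import HarnessLib

/-!
# `VNPnb^ℂ ⊆ VPnb^ℂ ↔ (VP ℂ = VNP ℂ ∧ B_nb)` and `B_nb → NF_ℂ` (route `VPBoundarySquare`)

FILE 1c of O-L3-14 «`B_nb` is the GRH-slot» (decomp-valiant lens 3, g39; aside `B_nb` = item 23487
= `VNPnbPFamSubsetVNP ℂ`). With FILE 1a (`bitSplit`, `aeval_powerSubst_bitSplit`) and FILE 1b
((L) `isVNPnbFamily_bitSplit`; T1 ⟹ `collapse_and_booleanNbDefinable_of_nbCollapse`):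

* §1 transport of `VNPnb` along renamings of the free variables (Bürgisser 2000 Rem. 2.2 bookkeeping).
* §2 **T2 ⟹** `nbNormalForm_of_booleanNbDefinable`: `B_nb → NF_ℂ`, where «`NF_ℂ`» is the normal
  form of Bürgisser 2024 Cor. 4.7 over `ℂ` — every `VNPnb^ℂ` family is a power substitution
  `Z ↦ X^{2^ℓ}` (`ℓ` p-bounded) of a `VNP^ℂ` family — VERBATIM the hypothesis `hNF` of the Literature
  theorem `Bur24_thm_4_8_mp_of_normalForm` at `k := ℂ` (`Bur24PowerSubstitution`, l.173). Proof:
  bit-split (FILE 1b (L): a multilinear `VNPnb` p-family), rename to `Fin (w n · L n)`, apply `B_nb`.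
* §3 **T1 ⟸** `nbCollapse_of_collapse_of_booleanNbDefinable`: `VP ℂ = VNP ℂ → B_nb → NbCollapse` —
  exactly as printed («Thm. 4.8 is immediate from Cor. 4.7»): `Bur24_thm_4_8_mp_of_normalForm` fed
  with §2. Hence the GRH-free skeleton of Thm. 4.10 (2), `nbCollapse_iff :
  NbCollapse ↔ (VP ℂ = VNP ℂ ∧ B_nb)`, and its two readings: under the collapse `NbCollapse ↔ B_nb`
  (the slot), and under `B_nb` alone `VP ℂ = VNP ℂ ↔ NbCollapse` (Thm. 4.10 (2)'s conclusion with
  `B_nb` in place of GRH; GRH re-enters only as `ERH → VP = VNP → B_nb`, FILE `…NbTransfer`).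

«`NbCollapse`» names the STATEMENT `∀ v f, IsVNPnbFamily f → IsVPnbFamily f` over `ℂ` and «`NF_ℂ`»
the statement displayed in §2; both are WRITTEN OUT in every signature (no `Prop` definitions —
a cited closed `Prop` in a helper file would be a vendored fact). Nothing here is constant-free
(Bürgisser's `VNPnb⁰`-closure question, 2024 p0017, untouched); `B_nb` stays OPEN; no tag moves;
`VP ≠ VNP` is not proved by anything here. The converse `NF_ℂ → B_nb` (truncation inside `VNP`)
and `U_ε^Σ ↔ B_nb` are staged next.

References: [Burgisser2024Completeness, §4.2: Cor. 4.7, Thm. 4.8, Rem. 4.9, Thm. 4.10 (2)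
(p0016–p0017)]; [BhargavDwivediSaxena2024, Lemma 4.1 (p. 13), §6 (p. 16)]; [Burgisser2000, Rem. 2.2].
-/

set_option linter.dupNamespace false

noncomputable section

open MvPolynomial Finset
open Literature.Computability.AlgebraicComplexity
open Summit.ValiantsHypothesis.ValiantsHypothesis.Theorems.VPBoundarySquarePresentableSplit
  (isPComputable_of_isVNPFamily_of_vp_eq_vnp)
open Summit.ValiantsHypothesis.ValiantsHypothesis.Theorems.VPBoundarySquareNbBitSplit
open Summit.ValiantsHypothesis.ValiantsHypothesis.Theorems.VPBoundarySquareNbGRHSlot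

namespace Summit.ValiantsHypothesis.ValiantsHypothesis.Theorems.VPBoundarySquareNbCollapseIff

/-! ### §1 Transport of `VNPnb` along renamings -/

section Transport

variable {F : Type*} [Field F] {σ τ : ℕ → Type*} [∀ n, Fintype (σ n)] [∀ n, Fintype (τ n)]

/-- `VNPnb^F` is stable under renamings of the free variables into p-bounded variable types:
rename the `VPnb` witness along `Sum.map e id` (`IsVPnbFamily.rename`) — the Boolean sum commutes
(`boolSum_rename_sumMap`). [cite: Burgisser2000, Rem. 2.2] -/
theorem isVNPnbFamily_rename {f : ∀ n, MvPolynomial (σ n) F} (hf : IsVNPnbFamily f)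
    (e : ∀ n, σ n → τ n) (hτ : IsPBounded fun n => Fintype.card (τ n)) :
    IsVNPnbFamily fun n => rename (e n) (f n) := by
  obtain ⟨u, G, hG, hfG⟩ := hf
  refine ⟨u, fun n => rename (Sum.map (e n) id) (G n), hG.rename _ ?_, fun n => ?_⟩
  · exact (IsPBounded.add_holds hτ hG.1).mono fun n => by
      simp only [Fintype.card_sum, Fintype.card_fin]; omega
  · simp only [hfG n, boolSum_rename_sumMap]

/-- The same along equivalences (no size hypothesis: `#τ n = #σ n`). [cite: Burgisser2000, Rem. 2.2] -/
theorem isVNPnbFamily_renameEquiv (e : ∀ n, σ n ≃ τ n) {f : ∀ n, MvPolynomial (σ n) F}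
    (hf : IsVNPnbFamily f) : IsVNPnbFamily fun n => renameEquiv F (e n) (f n) := by
  have hσ : IsPBounded fun n => Fintype.card (σ n) := by
    obtain ⟨u, G, hG, -⟩ := hf
    exact hG.1.mono fun n => by simp only [Fintype.card_sum, Fintype.card_fin]; omega
  simpa only [renameEquiv_apply] using
    isVNPnbFamily_rename hf (fun n => ⇑(e n)) (hσ.mono fun n => (Fintype.card_congr (e n)).ge)

end Transport

/-! ### §2 T2 ⟹ : `B_nb → NF_ℂ` -/

/-- **T2 ⟹ (`B_nb → NF_ℂ`).** If every `VNPnb^ℂ` p-family is in `VNP` (`B_nb`), then every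
`VNPnb^ℂ` family `f` (variables `Fin (w n)`) is a power substitution `Z ↦ X_{v(Z)}^{2^{ℓ(Z)}}`, `ℓ`
p-bounded, of a `VNP^ℂ` family `g` (variables `Fin (a n)`): take `g :=` the bit-split of `f`
(FILE 1b `isVNPnbFamily_bitSplit`: a multilinear `VNPnb` p-family, bit-length `L n` p-bounded)
renamed along `finProdFinEquiv : Fin (w n) × Fin (L n) ≃ Fin (w n · L n)`, in `VNP` by `B_nb`;
the substitution `Y_(i,j) ↦ X_i^{2^j}` recovers `f` (FILE 1a `aeval_powerSubst_bitSplit`). The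
conclusion is VERBATIM the hypothesis `hNF` of `Bur24_thm_4_8_mp_of_normalForm` at `k := ℂ`
(the normal form of Cor. 4.7 — Malod's theorem for `𝔽_p` — here DERIVED over `ℂ` from `B_nb`).
[cite: Burgisser2024Completeness, Cor. 4.7 and Thm. 4.8 (p0017 L22–L36)] -/
theorem nbNormalForm_of_booleanNbDefinable (hB : VNPnbPFamSubsetVNP ℂ)
    (w : ℕ → ℕ) (f : ∀ n, MvPolynomial (Fin (w n)) ℂ) (hf : IsVNPnbFamily f) :
    ∃ (a : ℕ → ℕ) (g : ∀ n, MvPolynomial (Fin (a n)) ℂ) (v : ∀ n, Fin (a n) → Fin (w n))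
      (ℓ : ∀ n, Fin (a n) → ℕ), IsVNPFamily g ∧ (IsPBounded fun n => Finset.univ.sup (ℓ n)) ∧
        ∀ n, f n = MvPolynomial.aeval (fun z => (X (v n z) : MvPolynomial (Fin (w n)) ℂ) ^
          2 ^ ℓ n z) (g n) := by
  obtain ⟨L, hL, hdeg, hnb, hpf⟩ := isVNPnbFamily_bitSplit hf
  have e : ∀ n, Fin (w n) × Fin (L n) ≃ Fin (w n * L n) := fun n => finProdFinEquiv
  refine ⟨fun n => w n * L n, fun n => renameEquiv ℂ (e n) (bitSplit (L n) (f n)),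
    fun n z => ((e n).symm z).1, fun n z => (((e n).symm z).2 : ℕ),
    hB _ _ ((isPFamily_renameEquiv_iff e _).2 hpf) (isVNPnbFamily_renameEquiv e hnb),
    hL.mono fun n => Finset.sup_le fun z _ => (Fin.is_lt _).le, fun n => ?_⟩
  simp only [renameEquiv_apply, aeval_rename]
  exact (aeval_powerSubst_bitSplit (L n) (f n) (hdeg n)).symm.trans
    (congrArg (fun θ => aeval θ (bitSplit (L n) (f n)))
      (funext fun z => by simp only [Function.comp_apply, Equiv.symm_apply_apply]))

/-! ### §3 T1 ⟸ and the GRH-free skeleton of Thm. 4.10 (2) -/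

/-- **T1 ⟸ (`VP ℂ = VNP ℂ → B_nb → NbCollapse`)**, as printed: Thm. 4.8 "⇒" from the normal form
(`Bur24_thm_4_8_mp_of_normalForm` with §2's `NF_ℂ`), the collapse read on `Fin (a n)`-indexed
families (`isPComputable_of_isVNPFamily_of_vp_eq_vnp`). Unfolded: bit-split, `B_nb`, collapse,
power-substitute back (`IsVPFamily.isVPnbFamily_powerSubst`).
[cite: Burgisser2024Completeness, Thm. 4.8, Rem. 4.9, Thm. 4.10 (2) (p0017)] -/
theorem nbCollapse_of_collapse_of_booleanNbDefinable (hEq : VP ℂ = VNP ℂ)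
    (hB : VNPnbPFamSubsetVNP ℂ) (v : ℕ → ℕ) (f : ∀ n, MvPolynomial (Fin (v n)) ℂ)
    (hf : IsVNPnbFamily f) : IsVPnbFamily f :=
  Bur24_thm_4_8_mp_of_normalForm (nbNormalForm_of_booleanNbDefinable hB)
    (fun _ _ hg => ⟨hg.1, isPComputable_of_isVNPFamily_of_vp_eq_vnp hEq hg⟩) v f hf

/-- **GRH-free skeleton of Bürgisser 2024 Thm. 4.10 (2)**: over `ℂ`, unconditionally,
`VNPnb ⊆ VPnb ↔ (VP = VNP ∧ B_nb)` (⟹ FILE 1b; ⟸ above).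
[cite: Burgisser2024Completeness, Thm. 4.10 (2) (p0017)] -/
theorem nbCollapse_iff :
    (∀ (v : ℕ → ℕ) (f : ∀ n, MvPolynomial (Fin (v n)) ℂ), IsVNPnbFamily f → IsVPnbFamily f) ↔
      (VP ℂ = VNP ℂ ∧ VNPnbPFamSubsetVNP ℂ) :=
  ⟨collapse_and_booleanNbDefinable_of_nbCollapse,
    fun h => nbCollapse_of_collapse_of_booleanNbDefinable h.1 h.2⟩

/-- **The slot.** In the collapse world `VP ℂ = VNP ℂ`: `VNPnb ⊆ VPnb ↔ B_nb` — so the lineage's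
`{ERH, Bur24_thm_4_10_2}` debt (FILE `…NbTransfer`) is exactly the arrow `VP = VNP → B_nb`.
[cite: Burgisser2024Completeness, Thm. 4.10 (2) (p0017)] -/
theorem nbCollapse_iff_booleanNbDefinable_of_collapse (hEq : VP ℂ = VNP ℂ) :
    (∀ (v : ℕ → ℕ) (f : ∀ n, MvPolynomial (Fin (v n)) ℂ), IsVNPnbFamily f → IsVPnbFamily f) ↔
      VNPnbPFamSubsetVNP ℂ :=
  ⟨booleanNbDefinable_of_nbCollapse, nbCollapse_of_collapse_of_booleanNbDefinable hEq⟩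

/-- **Thm. 4.10 (2) with `B_nb` in place of GRH.** Under `B_nb` alone, unconditionally:
`VP ℂ = VNP ℂ ↔ VNPnb^ℂ ⊆ VPnb^ℂ` (Bürgisser proves this conclusion from GRH).
[cite: Burgisser2024Completeness, Thm. 4.10 (2) (p0017)] -/
theorem vp_eq_vnp_iff_nbCollapse_of_booleanNbDefinable (hB : VNPnbPFamSubsetVNP ℂ) :
    VP ℂ = VNP ℂ ↔
      ∀ (v : ℕ → ℕ) (f : ∀ n, MvPolynomial (Fin (v n)) ℂ), IsVNPnbFamily f → IsVPnbFamily f :=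
  ⟨fun hEq => nbCollapse_of_collapse_of_booleanNbDefinable hEq hB, vp_eq_vnp_of_nbCollapse⟩

/-- `NbCollapse → NF_ℂ` (through `B_nb`): in particular the normal form of Cor. 4.7 holds over `ℂ`
in the world `VPnb^ℂ = VNPnb^ℂ`. [cite: Burgisser2024Completeness, Cor. 4.7, Thm. 4.10 (2) (p0017)] -/
theorem nbNormalForm_of_nbCollapse
    (h : ∀ (v : ℕ → ℕ) (f : ∀ n, MvPolynomial (Fin (v n)) ℂ), IsVNPnbFamily f → IsVPnbFamily f)
    (w : ℕ → ℕ) (f : ∀ n, MvPolynomial (Fin (w n)) ℂ) (hf : IsVNPnbFamily f) :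
    ∃ (a : ℕ → ℕ) (g : ∀ n, MvPolynomial (Fin (a n)) ℂ) (v : ∀ n, Fin (a n) → Fin (w n))
      (ℓ : ∀ n, Fin (a n) → ℕ), IsVNPFamily g ∧ (IsPBounded fun n => Finset.univ.sup (ℓ n)) ∧
        ∀ n, f n = MvPolynomial.aeval (fun z => (X (v n z) : MvPolynomial (Fin (w n)) ℂ) ^
          2 ^ ℓ n z) (g n) :=
  nbNormalForm_of_booleanNbDefinable (booleanNbDefinable_of_nbCollapse h) w f hf

end Summit.ValiantsHypothesis.ValiantsHypothesis.Theorems.VPBoundarySquareNbCollapseIff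

end
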